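import Mathlib
import Summits.QuantumFields.QCD.Theorems.QuarksAsStableActionUnquenchedChessboardBoundPeelFloorAux
import HarnessLib

/-!
# The floor from the peels, part 2: the peeling recursion (crux stmt-QuantumFields-9735, line `Sketch`)

The lead's stub `stub_signedFloor` of the line `Sketch` REDUCED to three reflection-positivity
peeling inequalities at fixed reflection planes and the time-translation covariance of slabs
(`stub_torusPeel`, `stub_sitePeel`, `stub_linkPeel`, `stub_shiftZb` of the skeleton):
`signedFloor_of_peels` proves the floor `Re Z ≥ e^{-(a+εβ)L⁴}` on the signed un-normalised
partition function of `N_f` Wilson quarks on any mass window `[m_lo, m_hi] ⊂ (-1, ∞)` from the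
pure-gauge entropy floor and the peels, by the normalised recursion
`n(slab of length ℓ) ≥ R · q^{4ℓ}` (`peel_recursion`; halving the slab at each step — site
reflection for even lengths, link reflection for odd lengths; every Cauchy–Schwarz step is
homogeneous, and the slice floor `q R` / reference ceiling `R` are the window bounds of part 1
integrated against `e^{-βS_W} ∏dU`), ending in `Re Z(univ) ≥ R q^{4L} ∏_f(m_f+4)^{12L⁴} Z_g` with
`q^{4L} = (9 c₁ / C₂³)^{48 N_f L⁴}`, `c₁ = m_lo + 1`, `C₂ = |m_lo| + |m_hi| + 8`.

* `re_signedZb_ge`, `re_signedZb_le` — the slice floor and the reference ceilings (from the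
  pathwise `window_floor_prod`, `window_ceiling_prod` of part 1);
* `peel_arith`, `slab_shift_all`, `peel_recursion` — one step in numbers, all slab positions are
  equivalent, and the strong induction on the length;
* `signedFloor_of_peels` — the conclusion of `stub_signedFloor` from `hgauge` and the three peels.

All statements are proved.
-/

noncomputable section

open Matrix Complex Finset
open Literature.MathematicalPhysics.QuantumFieldTheory Literature.MathematicalPhysics.QuantumLattice
open Literature.Probability.LatticeModels
open scoped ComplexConjugate BigOperators

namespace Summit.QuantumFields.QCD.Theorems.QuarksAsStableAction

/-! ## Floor assembly, part D: integral bounds, the peeling recursion, the floor from the peels -/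

section FloorD

open MeasureTheory

variable {L : ℕ} [NeZero L]

/-- **Lower bound on the diluted signed partition function on a mass window**:
`c^{12|T|N_f} · ∏_f (m_f+4)^{12L⁴} · Z_g ≤ Re Zb(E)`. -/
theorem re_signedZb_ge (E : Finset (Edge 4 L)) (T : Finset (TorusSite 4 L))
    (hdir : ∀ e ∈ E, e.2 ∈ (univ : Finset (Fin 4)).erase 0)
    (hT : ∀ e ∈ E, e.1 ∈ T ∧ Literature.MathematicalPhysics.QuantumFieldTheory.Site.shift e.1 e.2 ∈ T)
    {mlo mhi : ℝ} (hmlo : -1 < mlo) {Nf : ℕ} (m : Fin Nf → ℝ) (hm : ∀ f, mlo ≤ m f ∧ m f ≤ mhi)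
    (β : ℝ) :
    ((mlo + 1) / (|mlo| + |mhi| + 8)) ^ (T.card * 12 * Nf) * (∏ f, (m f + 4) ^ (L ^ 4 * 12)) *
        ∫ U, Real.exp (-β * wilsonAction (fundamentalRep (Fin 3)) U)
          ∂(Measure.pi fun _ : Edge 4 L => haarProbability (Matrix.specialUnitaryGroup (Fin 3) ℂ)) ≤
      (∫ U, (∏ f, (bondWilsonDiracAP E U (m f)).det) *
          (Real.exp (-β * wilsonAction (fundamentalRep (Fin 3)) U) : ℂ)
          ∂(Measure.pi fun _ : Edge 4 L => haarProbability (Matrix.specialUnitaryGroup (Fin 3) ℂ))).re := by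
  rw [re_signedZb_eq, ← integral_const_mul]
  have hexp : Continuous fun U : GaugeConfig 4 L (Matrix.specialUnitaryGroup (Fin 3) ℂ) =>
      Real.exp (-β * wilsonAction (fundamentalRep (Fin 3)) U) :=
    ((UnquenchedChessboardBoundLine.continuous_wilsonAction_su3 (L := L)).const_mul (-β)).rexp
  refine integral_mono ((integrable_of_continuous_su3 _ hexp).const_mul _)
    (signedZb_eq_ofReal E β m).2.1 fun U => ?_
  exact mul_le_mul_of_nonneg_right (window_floor_prod E T hdir hT hmlo m hm U) (Real.exp_nonneg _)

/-- **Upper bound on the diluted signed partition function on a mass window**: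
`Re Zb(E) ≤ Cc^{12|T|N_f} · ∏_f (m_f+4)^{12L⁴} · Z_g`. -/
theorem re_signedZb_le (E : Finset (Edge 4 L)) (T : Finset (TorusSite 4 L))
    (hdir : ∀ e ∈ E, e.2 ∈ (univ : Finset (Fin 4)).erase 0)
    (hT : ∀ e ∈ E, e.1 ∈ T ∧ Literature.MathematicalPhysics.QuantumFieldTheory.Site.shift e.1 e.2 ∈ T)
    {mlo mhi : ℝ} (hmlo : -1 < mlo) {Nf : ℕ} (m : Fin Nf → ℝ) (hm : ∀ f, mlo ≤ m f ∧ m f ≤ mhi)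
    (β : ℝ) :
    (∫ U, (∏ f, (bondWilsonDiracAP E U (m f)).det) *
          (Real.exp (-β * wilsonAction (fundamentalRep (Fin 3)) U) : ℂ)
          ∂(Measure.pi fun _ : Edge 4 L => haarProbability (Matrix.specialUnitaryGroup (Fin 3) ℂ))).re ≤
      ((|mlo| + |mhi| + 8) / 3) ^ (T.card * 12 * Nf) * (∏ f, (m f + 4) ^ (L ^ 4 * 12)) *
        ∫ U, Real.exp (-β * wilsonAction (fundamentalRep (Fin 3)) U)
          ∂(Measure.pi fun _ : Edge 4 L => haarProbability (Matrix.specialUnitaryGroup (Fin 3) ℂ)) := by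
  rw [re_signedZb_eq, ← integral_const_mul]
  have hexp : Continuous fun U : GaugeConfig 4 L (Matrix.specialUnitaryGroup (Fin 3) ℂ) =>
      Real.exp (-β * wilsonAction (fundamentalRep (Fin 3)) U) :=
    ((UnquenchedChessboardBoundLine.continuous_wilsonAction_su3 (L := L)).const_mul (-β)).rexp
  refine integral_mono (signedZb_eq_ofReal E β m).2.1
    ((integrable_of_continuous_su3 _ hexp).const_mul _) fun U => ?_
  exact mul_le_mul_of_nonneg_right (window_ceiling_prod E T hdir hT hmlo m hm U) (Real.exp_nonneg _)

omit [NeZero L] in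
/-- **One peeling step in numbers**: from the Cauchy–Schwarz inequality `‖M‖² ≤ X · Y` of a peel,
the ceiling `Y ≤ R · W` on the reference and the floor `t · W ≤ Re M` on the mixed entry,
`(t²/R) · W ≤ X`. -/
theorem peel_arith {X Y R W t : ℝ} {M : ℂ} (hX : 0 ≤ X) (hCS : ‖M‖ ^ 2 ≤ X * Y) (hY : Y ≤ R * W)
    (hR : 0 < R) (hW : 0 < W) (ht : 0 ≤ t) (hM : t * W ≤ M.re) : t ^ 2 / R * W ≤ X := by
  have h1 : (t * W) ^ 2 ≤ ‖M‖ ^ 2 :=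
    pow_le_pow_left₀ (by positivity) (hM.trans (Complex.re_le_norm M)) 2
  have h2 : ‖M‖ ^ 2 ≤ X * (R * W) := hCS.trans (mul_le_mul_of_nonneg_left hY hX)
  have h3 : t ^ 2 * W * W ≤ X * R * W := by nlinarith [h1.trans h2]
  rw [div_mul_eq_mul_div, div_le_iff₀ hR]
  exact le_of_mul_le_mul_right h3 hW

omit [NeZero L] in
/-- Slabs at all time positions have the same `Z` once `Z` is invariant under the unit time shift. -/
theorem slab_shift_all [NeZero L] (Z : Finset (Edge 4 L) → ℂ)
    (hshift : ∀ (a : ZMod L) (ℓ : ℕ), Z (slabBonds (a + 1) ℓ) = Z (slabBonds a ℓ))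
    (a b : ZMod L) (ℓ : ℕ) : Z (slabBonds a ℓ) = Z (slabBonds b ℓ) := by
  have hn : ∀ (c : ZMod L) (n : ℕ), Z (slabBonds (c + n) ℓ) = Z (slabBonds c ℓ) := by
    intro c n
    induction n with
    | zero => simp
    | succ n ih => rw [Nat.cast_succ, ← add_assoc, hshift, ih]
  have ha : a = b + ((a - b).val : ℕ) := by rw [ZMod.natCast_zmod_val]; ring
  rw [ha, hn]

omit [NeZero L] in
/-- **The peeling recursion.** For a set function `Z` on bond sets (the diluted signed partition
functions), invariant under the unit time shift of slabs, with slice floor `q R W ≤ Re Z(slice 0)`,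
reference ceilings `Re Z(slice 0), Re Z(∅) ≤ R W` and the site/link peeling inequalities at the
fixed reflection planes (site: `t ↦ -t`, slab `[-p, p]`, upper half `[0, p]`; link: `t ↦ 1-t`,
slab `[-p, p+1]`, upper half `[1, p+1]`), every closed slab of length `1 ≤ ℓ ≤ L/2` has `R q^{4ℓ} W ≤ Re Z(slab)`
(strong induction on `ℓ`, halving the slab at each step). -/
theorem peel_recursion [NeZero L] (Z : Finset (Edge 4 L) → ℂ) {q R W : ℝ}
    (hq0 : 0 ≤ q) (hq1 : q ≤ 1) (hR : 0 < R) (hW : 0 < W)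
    (hshift : ∀ (a : ZMod L) (ℓ : ℕ), Z (slabBonds (a + 1) ℓ) = Z (slabBonds a ℓ))
    (hslice : q * R * W ≤ (Z (sliceBonds 0)).re)
    (hsliceU : (Z (sliceBonds 0)).re ≤ R * W)
    (hempty : (Z ∅).re ≤ R * W)
    (hsite : ∀ p : ℕ, 2 * p ≤ L / 2 → 0 ≤ (Z (slabBonds (-(p : ZMod L)) (2 * p))).re ∧
      ‖Z (slabBonds 0 p)‖ ^ 2 ≤ (Z (slabBonds (-(p : ZMod L)) (2 * p))).re * (Z (sliceBonds 0)).re)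
    (hlink : ∀ p : ℕ, 2 * p + 1 ≤ L / 2 → 0 ≤ (Z (slabBonds (-(p : ZMod L)) (2 * p + 1))).re ∧
      ‖Z (slabBonds 1 p)‖ ^ 2 ≤ (Z (slabBonds (-(p : ZMod L)) (2 * p + 1))).re * (Z ∅).re) :
    ∀ ℓ : ℕ, 1 ≤ ℓ → ℓ ≤ L / 2 → ∀ a : ZMod L, R * q ^ (4 * ℓ) * W ≤ (Z (slabBonds a ℓ)).re := by
  have hall := slab_shift_all Z hshift
  intro ℓ
  induction ℓ using Nat.strong_induction_on with
  | _ ℓ ih =>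
    intro h1 hℓ a
    rw [hall a 0]
    have hRne : R ≠ 0 := hR.ne'
    obtain ⟨p, rfl | rfl⟩ := Nat.even_or_odd' ℓ
    · -- even length `2p`, `p ≥ 1`: site peel in the middle slice
      have hp : 1 ≤ p := by omega
      obtain ⟨hX, hCS⟩ := hsite p hℓ
      rw [hall (-(p : ZMod L)) 0] at hX hCS
      have ht := ih p (by omega) hp (by omega) 0
      have h := peel_arith hX hCS hsliceU hR hW (by positivity) ht
      have heq : R * q ^ (4 * (2 * p)) = (R * q ^ (4 * p)) ^ 2 / R := by
        field_simp
        ring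
      rw [heq]
      exact h
    · obtain ⟨hX, hCS⟩ := hlink p hℓ
      rw [hall (-(p : ZMod L)) 0] at hX hCS
      rw [hall 1 0] at hCS
      rcases Nat.eq_zero_or_pos p with rfl | hp
      · -- length `1`: link peel, the mixed entry is a single slice
        have ht : q * R * W ≤ (Z (slabBonds 0 0)).re := by
          rw [slabBonds_zero]
          exact hslice
        have h := peel_arith hX hCS hempty hR hW (by positivity) ht
        refine le_trans (mul_le_mul_of_nonneg_right ?_ hW.le) h
        have heq : (q * R) ^ 2 / R = R * q ^ 2 := by
          field_simp
        rw [heq]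
        exact mul_le_mul_of_nonneg_left (pow_le_pow_of_le_one hq0 hq1 (by omega)) hR.le
      · -- odd length `2p+1`, `p ≥ 1`: link peel in the middle layer
        have ht := ih p (by omega) hp (by omega) 0
        have h := peel_arith hX hCS hempty hR hW (by positivity) ht
        refine le_trans (mul_le_mul_of_nonneg_right ?_ hW.le) h
        have heq : (R * q ^ (4 * p)) ^ 2 / R = R * q ^ (4 * (2 * p)) := by
          field_simp
          ring
        rw [heq]
        exact mul_le_mul_of_nonneg_left (pow_le_pow_of_le_one hq0 hq1 (by omega)) hR.le

/-- The sites of two slices number at most `2L³`. -/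
theorem card_union_sliceSites_le (t t' : ZMod L) :
    (sliceSites t ∪ sliceSites t').card ≤ 2 * L ^ 3 := by
  refine (Finset.card_union_le _ _).trans ?_
  rw [card_sliceSites, card_sliceSites]
  omega

/-- **The floor from the peels.** The pure-gauge entropy floor, the three reflection-positivity
peeling inequalities at the fixed reflection planes and the time-translation covariance of slabs
(torus → half-torus slab → … → single slice, halving the slab at each step; site reflection for
even lengths, link reflection for odd lengths) imply the floor on the signed
un-normalised partition function of the crux on any mass window `[m_lo, m_hi] ⊂ (-1, ∞)`:
`Re Z ≥ e^{-(a+εβ)L⁴}`. The slice floor and the reference ceilings are the pathwise window bounds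
on the diluted determinant (`window_floor_re_det`, `window_ceiling_norm_det`: spatial slices are
unions of isolated sites and `3`-regular pieces), integrated against `e^{-βS_W} ∏dU`. -/
theorem signedFloor_of_peels
    (hgauge : ∀ ε : ℝ, 0 < ε → ∃ a : ℝ, ∀ β : ℝ, 0 ≤ β → ∀ (L : ℕ) [NeZero L],
      Real.exp (-((a + ε * β) * (L : ℝ) ^ 4)) ≤
        ∫ U, Real.exp (-β * wilsonAction (fundamentalRep (Fin 3)) U)
          ∂(Measure.pi fun _ : Edge 4 L => haarProbability (Matrix.specialUnitaryGroup (Fin 3) ℂ)))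
    (htorus : ∀ (Nf L : ℕ) [NeZero L] [Fact (1 < L)], Even L → 4 ≤ L → ∀ (β : ℝ) (m : Fin Nf → ℝ),
      (∀ f, -1 < m f) →
      0 ≤ (∫ U, (∏ f, (bondWilsonDiracAP univ U (m f)).det) *
            (Real.exp (-β * wilsonAction (fundamentalRep (Fin 3)) U) : ℂ)
          ∂(Measure.pi fun _ : Edge 4 L => haarProbability (Matrix.specialUnitaryGroup (Fin 3) ℂ))).re ∧
      ‖∫ U, (∏ f, (bondWilsonDiracAP (slabBonds 0 (L / 2)) U (m f)).det) *
            (Real.exp (-β * wilsonAction (fundamentalRep (Fin 3)) U) : ℂ)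
          ∂(Measure.pi fun _ : Edge 4 L => haarProbability (Matrix.specialUnitaryGroup (Fin 3) ℂ))‖ ^ 2 ≤
        (∫ U, (∏ f, (bondWilsonDiracAP univ U (m f)).det) *
            (Real.exp (-β * wilsonAction (fundamentalRep (Fin 3)) U) : ℂ)
          ∂(Measure.pi fun _ : Edge 4 L => haarProbability (Matrix.specialUnitaryGroup (Fin 3) ℂ))).re *
        (∫ U, (∏ f, (bondWilsonDiracAP (sliceBonds 0 ∪ sliceBonds ((L / 2 : ℕ) : ZMod L)) U (m f)).det) *
            (Real.exp (-β * wilsonAction (fundamentalRep (Fin 3)) U) : ℂ)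
          ∂(Measure.pi fun _ : Edge 4 L => haarProbability (Matrix.specialUnitaryGroup (Fin 3) ℂ))).re)
    (hsite : ∀ (Nf L : ℕ) [NeZero L] [Fact (1 < L)], Even L → 4 ≤ L → ∀ (β : ℝ) (m : Fin Nf → ℝ),
      (∀ f, -1 < m f) → ∀ (p : ℕ), 2 * p ≤ L / 2 →
      0 ≤ (∫ U, (∏ f, (bondWilsonDiracAP (slabBonds (-(p : ZMod L)) (2 * p)) U (m f)).det) *
            (Real.exp (-β * wilsonAction (fundamentalRep (Fin 3)) U) : ℂ)
          ∂(Measure.pi fun _ : Edge 4 L => haarProbability (Matrix.specialUnitaryGroup (Fin 3) ℂ))).re ∧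
      ‖∫ U, (∏ f, (bondWilsonDiracAP (slabBonds 0 p) U (m f)).det) *
            (Real.exp (-β * wilsonAction (fundamentalRep (Fin 3)) U) : ℂ)
          ∂(Measure.pi fun _ : Edge 4 L => haarProbability (Matrix.specialUnitaryGroup (Fin 3) ℂ))‖ ^ 2 ≤
        (∫ U, (∏ f, (bondWilsonDiracAP (slabBonds (-(p : ZMod L)) (2 * p)) U (m f)).det) *
            (Real.exp (-β * wilsonAction (fundamentalRep (Fin 3)) U) : ℂ)
          ∂(Measure.pi fun _ : Edge 4 L => haarProbability (Matrix.specialUnitaryGroup (Fin 3) ℂ))).re *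
        (∫ U, (∏ f, (bondWilsonDiracAP (sliceBonds 0) U (m f)).det) *
            (Real.exp (-β * wilsonAction (fundamentalRep (Fin 3)) U) : ℂ)
          ∂(Measure.pi fun _ : Edge 4 L => haarProbability (Matrix.specialUnitaryGroup (Fin 3) ℂ))).re)
    (hlink : ∀ (Nf L : ℕ) [NeZero L] [Fact (1 < L)], Even L → 4 ≤ L → ∀ (β : ℝ), 0 ≤ β →
      ∀ (m : Fin Nf → ℝ), (∀ f, -1 < m f) → ∀ (p : ℕ), 2 * p + 1 ≤ L / 2 →
      0 ≤ (∫ U, (∏ f, (bondWilsonDiracAP (slabBonds (-(p : ZMod L)) (2 * p + 1)) U (m f)).det) *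
            (Real.exp (-β * wilsonAction (fundamentalRep (Fin 3)) U) : ℂ)
          ∂(Measure.pi fun _ : Edge 4 L => haarProbability (Matrix.specialUnitaryGroup (Fin 3) ℂ))).re ∧
      ‖∫ U, (∏ f, (bondWilsonDiracAP (slabBonds 1 p) U (m f)).det) *
            (Real.exp (-β * wilsonAction (fundamentalRep (Fin 3)) U) : ℂ)
          ∂(Measure.pi fun _ : Edge 4 L => haarProbability (Matrix.specialUnitaryGroup (Fin 3) ℂ))‖ ^ 2 ≤
        (∫ U, (∏ f, (bondWilsonDiracAP (slabBonds (-(p : ZMod L)) (2 * p + 1)) U (m f)).det) *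
            (Real.exp (-β * wilsonAction (fundamentalRep (Fin 3)) U) : ℂ)
          ∂(Measure.pi fun _ : Edge 4 L => haarProbability (Matrix.specialUnitaryGroup (Fin 3) ℂ))).re *
        (∫ U, (∏ f, (bondWilsonDiracAP ∅ U (m f)).det) *
            (Real.exp (-β * wilsonAction (fundamentalRep (Fin 3)) U) : ℂ)
          ∂(Measure.pi fun _ : Edge 4 L => haarProbability (Matrix.specialUnitaryGroup (Fin 3) ℂ))).re)
    (hshift : ∀ (Nf L : ℕ) [NeZero L] [Fact (1 < L)] (β : ℝ) (m : Fin Nf → ℝ) (a : ZMod L) (ℓ : ℕ),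
      ∫ U, (∏ f, (bondWilsonDiracAP (slabBonds (a + 1) ℓ) U (m f)).det) *
            (Real.exp (-β * wilsonAction (fundamentalRep (Fin 3)) U) : ℂ)
          ∂(Measure.pi fun _ : Edge 4 L => haarProbability (Matrix.specialUnitaryGroup (Fin 3) ℂ)) =
      ∫ U, (∏ f, (bondWilsonDiracAP (slabBonds a ℓ) U (m f)).det) *
            (Real.exp (-β * wilsonAction (fundamentalRep (Fin 3)) U) : ℂ)
          ∂(Measure.pi fun _ : Edge 4 L => haarProbability (Matrix.specialUnitaryGroup (Fin 3) ℂ)))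
    (Nf : ℕ) (mlo mhi ε : ℝ) (hmlo : -1 < mlo) (hε : 0 < ε) :
    ∃ a : ℝ, ∀ β : ℝ, 0 ≤ β → ∀ (L : ℕ) [NeZero L], Even L → 4 ≤ L → ∀ m : Fin Nf → ℝ,
      (∀ f, mlo ≤ m f ∧ m f ≤ mhi) →
      Real.exp (-((a + ε * β) * (L : ℝ) ^ 4)) ≤
        (∫ U, (∏ f, (wilsonDiracAP U (m f)).det) *
            (Real.exp (-β * wilsonAction (fundamentalRep (Fin 3)) U) : ℂ)
          ∂(Measure.pi fun _ : Edge 4 L => haarProbability (Matrix.specialUnitaryGroup (Fin 3) ℂ))).re := by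
  obtain ⟨a₀, ha₀⟩ := hgauge ε hε
  -- the window constants
  have hC2 : 0 < |mlo| + |mhi| + 8 := by positivity
  have hc0 : 0 < (mlo + 1) / (|mlo| + |mhi| + 8) := div_pos (by linarith) hC2
  have hc1 : (mlo + 1) / (|mlo| + |mhi| + 8) ≤ 1 := by
    rw [div_le_one hC2]
    have := le_abs_self mlo
    have := abs_nonneg mhi
    linarith
  have hCc1 : 1 ≤ (|mlo| + |mhi| + 8) / 3 := by
    rw [le_div_iff₀ (by norm_num : (0 : ℝ) < 3)]
    have := abs_nonneg mlo
    have := abs_nonneg mhi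
    linarith
  -- the ratio `r = c / Cc²` and its logarithm
  set r : ℝ := (mlo + 1) / (|mlo| + |mhi| + 8) / ((|mlo| + |mhi| + 8) / 3) ^ 2 with hr
  have hCc2 : 1 ≤ ((|mlo| + |mhi| + 8) / 3) ^ 2 := one_le_pow₀ hCc1
  have hr0 : 0 < r := div_pos hc0 (by positivity)
  have hr1 : r ≤ 1 := by
    rw [hr, div_le_one (by positivity)]
    exact hc1.trans hCc2
  refine ⟨a₀ + 48 * Nf * (-Real.log r), fun β hβ L _ hL h4 m hm => ?_⟩
  haveI : Fact (1 < L) := ⟨by omega⟩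
  have hm1 : ∀ f, -1 < m f := fun f => lt_of_lt_of_le hmlo (hm f).1
  -- the objects
  let Zb : Finset (Edge 4 L) → ℂ := fun E =>
    ∫ U, (∏ f, (bondWilsonDiracAP E U (m f)).det) *
        (Real.exp (-β * wilsonAction (fundamentalRep (Fin 3)) U) : ℂ)
      ∂(Measure.pi fun _ : Edge 4 L => haarProbability (Matrix.specialUnitaryGroup (Fin 3) ℂ))
  set Zg : ℝ := ∫ U, Real.exp (-β * wilsonAction (fundamentalRep (Fin 3)) U)
      ∂(Measure.pi fun _ : Edge 4 L => haarProbability (Matrix.specialUnitaryGroup (Fin 3) ℂ)) with hZg_def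
  set D : ℝ := ∏ f, (m f + 4) ^ (L ^ 4 * 12) with hD_def
  have hZg : Real.exp (-((a₀ + ε * β) * (L : ℝ) ^ 4)) ≤ Zg := ha₀ β hβ L
  have hZg0 : 0 < Zg := lt_of_lt_of_le (Real.exp_pos _) hZg
  have hD1 : 1 ≤ D := by
    rw [hD_def]
    calc (1 : ℝ) = ∏ _f : Fin Nf, (1 : ℝ) := Finset.prod_const_one.symm
      _ ≤ ∏ f, (m f + 4) ^ (L ^ 4 * 12) :=
          Finset.prod_le_prod (fun _ _ => zero_le_one) fun f _ =>
            one_le_pow₀ (by linarith [(hm f).1, hmlo])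
  have hW : 0 < D * Zg := mul_pos (by linarith) hZg0
  -- exponents
  set k : ℕ := L ^ 3 * 12 * Nf with hk
  set R : ℝ := (((|mlo| + |mhi| + 8) / 3) ^ 2) ^ k with hR_def
  have hR1 : 1 ≤ R := one_le_pow₀ hCc2
  have hR0 : 0 < R := by linarith
  have hq0 : 0 ≤ r ^ k := pow_nonneg hr0.le _
  have hq1 : r ^ k ≤ 1 := pow_le_one₀ hr0.le hr1
  have hqR : r ^ k * R = ((mlo + 1) / (|mlo| + |mhi| + 8)) ^ k := by
    rw [hR_def, ← mul_pow, hr, div_mul_cancel₀ _ (by positivity)]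
  -- reference ceilings: a bound `Cc^{12|T|Nf}` with `|T| ≤ 2L³` is at most `R`
  have hCcT : ∀ T : Finset (TorusSite 4 L), T.card ≤ 2 * L ^ 3 →
      ((|mlo| + |mhi| + 8) / 3) ^ (T.card * 12 * Nf) ≤ R := by
    intro T hT
    rw [hR_def, ← pow_mul]
    exact pow_le_pow_right₀ hCc1 (by rw [hk]; nlinarith [hT, Nat.zero_le Nf])
  -- slice floor and ceilings
  have hslice : r ^ k * R * (D * Zg) ≤ (Zb (sliceBonds 0)).re := by
    have h := re_signedZb_ge (sliceBonds (0 : ZMod L)) (sliceSites 0) (fun e he => sliceBonds_dir he)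
      (fun e he => sliceBonds_support he) hmlo m hm β
    rw [card_sliceSites, mul_assoc] at h
    rw [hqR]
    exact h
  have hsliceU : (Zb (sliceBonds 0)).re ≤ R * (D * Zg) := by
    have h := re_signedZb_le (sliceBonds (0 : ZMod L)) (sliceSites 0) (fun e he => sliceBonds_dir he)
      (fun e he => sliceBonds_support he) hmlo m hm β
    rw [mul_assoc] at h
    refine h.trans (mul_le_mul_of_nonneg_right (hCcT _ ?_) hW.le)
    rw [card_sliceSites]
    omega
  have hempty : (Zb ∅).re ≤ R * (D * Zg) := by
    have h := re_signedZb_le (L := L) ∅ ∅ (fun e he => by simp at he) (fun e he => by simp at he)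
      hmlo m hm β
    rw [mul_assoc] at h
    exact h.trans (mul_le_mul_of_nonneg_right (hCcT _ (by simp)) hW.le)
  have hplanes : (Zb (sliceBonds 0 ∪ sliceBonds ((L / 2 : ℕ) : ZMod L))).re ≤ R * (D * Zg) := by
    have h := re_signedZb_le (sliceBonds 0 ∪ sliceBonds ((L / 2 : ℕ) : ZMod L))
      (sliceSites 0 ∪ sliceSites ((L / 2 : ℕ) : ZMod L)) (fun e he => union_sliceBonds_dir he)
      (fun e he => union_sliceBonds_support he) hmlo m hm β
    rw [mul_assoc] at h
    exact h.trans (mul_le_mul_of_nonneg_right (hCcT _ (card_union_sliceSites_le _ _)) hW.le)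
  -- the recursion down to the half-torus slab
  have hrec := peel_recursion Zb hq0 hq1 hR0 hW (fun a ℓ => hshift Nf L β m a ℓ) hslice hsliceU hempty
    (fun p hp => hsite Nf L hL h4 β m hm1 p hp)
    (fun p hp => hlink Nf L hL h4 β hβ m hm1 p hp) (L / 2) (by omega) le_rfl 0
  -- the torus step
  obtain ⟨hX, hCS⟩ := htorus Nf L hL h4 β m hm1
  have hfin := peel_arith hX hCS hplanes hR0 hW (by positivity) hrec
  -- bookkeeping of the constants
  have hL2 : L / 2 * 2 = L := Nat.div_mul_cancel (even_iff_two_dvd.mp hL)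
  have h1 : ((r ^ k) ^ (4 * (L / 2))) ^ 2 = r ^ (48 * L ^ 4 * Nf) := by
    rw [← pow_mul, ← pow_mul]
    congr 1
    rw [hk, mul_assoc 4, hL2]
    ring
  have heq : (R * (r ^ k) ^ (4 * (L / 2))) ^ 2 / R = R * r ^ (48 * L ^ 4 * Nf) := by
    rw [mul_pow, h1, sq, mul_assoc, mul_div_assoc, mul_div_cancel_left₀ _ hR0.ne']
  have hZ : Zb univ = ∫ U, (∏ f, (wilsonDiracAP U (m f)).det) *
      (Real.exp (-β * wilsonAction (fundamentalRep (Fin 3)) U) : ℂ)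
      ∂(Measure.pi fun _ : Edge 4 L => haarProbability (Matrix.specialUnitaryGroup (Fin 3) ℂ)) := by
    simp only [Zb, bondWilsonDiracAP_univ]
  rw [← hZ]
  refine le_trans ?_ hfin
  rw [heq]
  have hlhs : Real.exp (-((a₀ + 48 * Nf * (-Real.log r) + ε * β) * (L : ℝ) ^ 4)) =
      r ^ (48 * L ^ 4 * Nf) * Real.exp (-((a₀ + ε * β) * (L : ℝ) ^ 4)) := by
    rw [← Real.exp_log hr0, ← Real.exp_nat_mul, Real.exp_log hr0, ← Real.exp_add]
    congr 1
    push_cast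
    ring
  rw [hlhs]
  calc r ^ (48 * L ^ 4 * Nf) * Real.exp (-((a₀ + ε * β) * (L : ℝ) ^ 4))
      ≤ r ^ (48 * L ^ 4 * Nf) * Zg := mul_le_mul_of_nonneg_left hZg (pow_nonneg hr0.le _)
    _ ≤ r ^ (48 * L ^ 4 * Nf) * (D * Zg) :=
        mul_le_mul_of_nonneg_left (le_mul_of_one_le_left hZg0.le hD1) (pow_nonneg hr0.le _)
    _ ≤ R * r ^ (48 * L ^ 4 * Nf) * (D * Zg) := by
        rw [mul_assoc R]
        exact le_mul_of_one_le_left (mul_nonneg (pow_nonneg hr0.le _) hW.le) hR1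

end FloorD

end Summit.QuantumFields.QCD.Theorems.QuarksAsStableAction

end
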